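import Literature.NumberTheory.Sieve.TwistedCharacterSmoothSum
import Literature.NumberTheory.Sieve.SmoothRieszMeanSaddle
import HarnessLib

/-!
# Bounding character-twisted smooth weighted sums from the decay of `L(s, χ; y)`

Topic `Literature/NumberTheory/Sieve`; a PROVED tool file toward
`Literature.NumberTheory.DiophantineGeometry.XYZUpperHalf` ([Harper2016, Cor. 1]; non-principal
characters on the major arcs). From the Mellin representation
`∑_{n ∈ S(X,y)} χ(n) W_λ(n/X) = (2π)⁻¹ ∫ X^{σ+it} Ŵ_λ(σ+it) L(σ+it, χ; y) dt`
(`TwistedWeight.sum_char_twistWeight_eq_integral`), the decay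
`‖L(σ+it, χ; y)‖ ≤ ζ(σ, y) e^{−D_χ(t)/5}` (`norm_smoothLC_le_mul_exp`) and the bounds on `Ŵ_λ`
(`‖Ŵ_λ‖ ≤ 1`, `‖Ŵ_λ(s)‖ ≤ C_λ/(|s+2||s+3||s+4|)`):

`norm_char_smoothSum_le`: if `D_χ(t) ≥ D₀` for `|t| ≤ T₀` (`T₀ > 0`), then
`‖∑_{n ∈ S(X,y)} χ(n) W_λ(n/X)‖ ≤ (X^σ ζ(σ,y)/(2π)) (2T₀ e^{−D₀/5} + 2π C_λ/T₀²)`.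

## References

* A. J. Harper, Compositio Math. 152 (2016), §2.2 and Appendix [Harper2016].
-/

noncomputable section

open Real Complex MeasureTheory Set Filter
open scoped FourierTransform Topology

namespace Literature.NumberTheory.Sieve

namespace TwistedWeight

variable {q : ℕ}

set_option maxHeartbeats 1000000 in
/-- **The character-twisted smooth sum from the decay of `L(s, χ; y)`.** See the module docstring.
[cite: Harper2016, §2.2, Appendix] -/
theorem norm_char_smoothSum_le {X σ T₀ D₀ : ℝ} (hX : 0 < X) (hσ : 3 / 5 ≤ σ) (y : ℕ)
    (χ : DirichletCharacter ℂ q) (lam : ℝ) (hT₀ : 0 < T₀)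
    (hD : ∀ t : ℝ, |t| ≤ T₀ → D₀ ≤ ∑ p ∈ Nat.primesLE y,
      (p : ℝ) ^ (-σ) * (1 - (χ (p : ZMod q) * (p : ℂ) ^ (-((t : ℂ) * I))).re)) :
    ‖∑ n ∈ Nat.smoothNumbersUpTo ⌊X⌋₊ (y + 1), χ (n : ZMod q) * twistWeight lam (n / X)‖ ≤
      (X ^ σ * smoothZeta σ y / (2 * π)) *
        (2 * T₀ * Real.exp (-(D₀ / 5)) +
          2 * π * (2 + 6 * (2 * π * |lam|) + 6 * (2 * π * |lam|) ^ 2 + (2 * π * |lam|) ^ 3) / T₀ ^ 2) := by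
  have hσ0 : 0 < σ := by linarith
  have hζ : 0 < smoothZeta σ y := smoothZeta_pos hσ0
  set Cl : ℝ := 2 + 6 * (2 * π * |lam|) + 6 * (2 * π * |lam|) ^ 2 + (2 * π * |lam|) ^ 3 with hCl
  have hCl0 : 0 ≤ Cl := by have := Real.pi_pos; positivity
  rw [sum_char_twistWeight_eq_integral hX hσ0 y χ lam, norm_smul, Real.norm_eq_abs,
    abs_of_pos (by positivity : (0 : ℝ) < 1 / (2 * π))]
  -- the integrand and its majorant
  set F : ℝ → ℂ := fun t => (X : ℂ) ^ ((σ : ℂ) + t * I) * twistMellin lam (σ + t * I) * smoothLC χ ((σ : ℂ) + t * I) y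
    with hF
  set M : ℝ → ℝ := fun t => X ^ σ * smoothZeta σ y *
      (Set.indicator (Set.Icc (-T₀) T₀) (fun _ => Real.exp (-(D₀ / 5))) t + (2 * Cl / T₀) / (T₀ ^ 2 + t ^ 2)) with hM
  -- pointwise bound `‖F t‖ ≤ M t`
  have hXpow : ∀ t : ℝ, ‖(X : ℂ) ^ ((σ : ℂ) + t * I)‖ = X ^ σ := fun t => by
    rw [Complex.norm_cpow_eq_rpow_re_of_pos hX]; simp
  have hpt : ∀ t : ℝ, ‖F t‖ ≤ M t := by
    intro t
    have hs : 0 < ((σ : ℂ) + t * I).re := by simp; exact hσ0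
    have hL := norm_smoothLC_le_mul_exp χ hσ t y
    have hW1 : ‖twistMellin lam (σ + t * I)‖ ≤ 1 := norm_twistMellin_le_one hs.le lam
    simp only [hF, hM, norm_mul, hXpow t]
    rw [mul_assoc (X ^ σ), mul_assoc (X ^ σ)]
    apply mul_le_mul_of_nonneg_left _ (by positivity)
    by_cases ht : |t| ≤ T₀
    · -- `‖Ŵ‖ ‖L‖ ≤ 1 · ζ e^{-D₀/5}`
      have hmem : t ∈ Set.Icc (-T₀) T₀ := ⟨by linarith [(abs_le.mp ht).1], (abs_le.mp ht).2⟩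
      rw [Set.indicator_of_mem hmem]
      have hexp : Real.exp (-(1 / 5) * ∑ p ∈ Nat.primesLE y,
          (p : ℝ) ^ (-σ) * (1 - (χ (p : ZMod q) * (p : ℂ) ^ (-((t : ℂ) * I))).re)) ≤ Real.exp (-(D₀ / 5)) := by
        apply Real.exp_le_exp.mpr
        have := hD t ht; linarith
      have h2 : 0 ≤ (2 * Cl / T₀) / (T₀ ^ 2 + t ^ 2) := by positivity
      calc ‖twistMellin lam (σ + t * I)‖ * ‖smoothLC χ ((σ : ℂ) + t * I) y‖
          ≤ 1 * (smoothZeta σ y * Real.exp (-(D₀ / 5))) :=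
            mul_le_mul hW1 (hL.trans (mul_le_mul_of_nonneg_left hexp hζ.le)) (norm_nonneg _) zero_le_one
        _ ≤ smoothZeta σ y * (Real.exp (-(D₀ / 5)) + (2 * Cl / T₀) / (T₀ ^ 2 + t ^ 2)) := by nlinarith
    · -- `‖Ŵ‖ ‖L‖ ≤ (C_λ/|t|³) ζ ≤ ζ (2C_λ/T₀)/(T₀² + t²)`
      push Not at ht
      rw [Set.indicator_of_notMem (fun h => absurd (abs_le.mpr ⟨by linarith [h.1], h.2⟩) (not_le.mpr ht)), zero_add]
      have hLζ : ‖smoothLC χ ((σ : ℂ) + t * I) y‖ ≤ smoothZeta σ y := by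
        refine hL.trans ?_
        have : Real.exp (-(1 / 5) * ∑ p ∈ Nat.primesLE y,
            (p : ℝ) ^ (-σ) * (1 - (χ (p : ZMod q) * (p : ℂ) ^ (-((t : ℂ) * I))).re)) ≤ 1 := by
          rw [Real.exp_le_one_iff]
          have hsum : 0 ≤ ∑ p ∈ Nat.primesLE y, (p : ℝ) ^ (-σ) * (1 - (χ (p : ZMod q) * (p : ℂ) ^ (-((t : ℂ) * I))).re) := by
            refine Finset.sum_nonneg fun p hp => ?_
            have hp0 : 0 < p := (Nat.mem_primesLE.mp hp).2.pos
            have hre : (χ (p : ZMod q) * (p : ℂ) ^ (-((t : ℂ) * I))).re ≤ 1 := by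
              refine (Complex.re_le_norm _).trans ?_
              rw [norm_mul, Complex.norm_natCast_cpow_of_pos hp0]
              simpa using DirichletCharacter.norm_le_one χ (p : ZMod q)
            have : 0 ≤ (p : ℝ) ^ (-σ) := by positivity
            nlinarith
          nlinarith
        nlinarith
      -- decay of `Ŵ`
      have hWd := norm_twistMellin_le_decay hs lam
      rw [← hCl] at hWd
      have habs0 : 0 < |t| := lt_trans hT₀ ht
      have hge : ∀ k : ℝ, |t| ≤ ‖(σ : ℂ) + t * I + k‖ := by
        intro k
        have : |((σ : ℂ) + t * I + k).im| ≤ ‖(σ : ℂ) + t * I + k‖ := Complex.abs_im_le_norm _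
        simpa using this
      have hprod : |t| ^ 3 ≤ ‖(σ : ℂ) + t * I + 2‖ * ‖(σ : ℂ) + t * I + 3‖ * ‖(σ : ℂ) + t * I + 4‖ := by
        have h2 := hge 2; have h3 := hge 3; have h4 := hge 4
        push_cast at h2 h3 h4
        calc |t| ^ 3 = |t| * |t| * |t| := by ring
          _ ≤ _ := by
            apply mul_le_mul (mul_le_mul h2 h3 (abs_nonneg _) (norm_nonneg _)) h4 (abs_nonneg _) (by positivity)
      have hW' : ‖twistMellin lam (σ + t * I)‖ ≤ Cl / |t| ^ 3 :=
        hWd.trans (div_le_div_of_nonneg_left hCl0 (by positivity) hprod)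
      have hden : Cl / |t| ^ 3 ≤ (2 * Cl / T₀) / (T₀ ^ 2 + t ^ 2) := by
        have ht2 : T₀ ^ 2 ≤ t ^ 2 := by
          have h := pow_le_pow_left₀ hT₀.le ht.le 2
          rwa [sq_abs] at h
        have h1 : |t| ^ 3 = |t| * t ^ 2 := by rw [← sq_abs]; ring
        have h2 : T₀ * (T₀ ^ 2 + t ^ 2) ≤ 2 * (|t| * t ^ 2) := by
          nlinarith [mul_le_mul ht.le ht2 (by positivity) (abs_nonneg t),
            mul_le_mul_of_nonneg_right ht.le (sq_nonneg t)]
        rw [div_div, div_le_div_iff₀ (by positivity) (by positivity), h1]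
        have := mul_le_mul_of_nonneg_left h2 hCl0
        nlinarith
      calc ‖twistMellin lam (σ + t * I)‖ * ‖smoothLC χ ((σ : ℂ) + t * I) y‖
          ≤ (Cl / |t| ^ 3) * smoothZeta σ y := mul_le_mul hW' hLζ (norm_nonneg _) (by positivity)
        _ ≤ ((2 * Cl / T₀) / (T₀ ^ 2 + t ^ 2)) * smoothZeta σ y := mul_le_mul_of_nonneg_right hden hζ.le
        _ = smoothZeta σ y * ((2 * Cl / T₀) / (T₀ ^ 2 + t ^ 2)) := mul_comm _ _
  -- integrability of the majorant and its integral
  have hInd : Integrable (Set.indicator (Set.Icc (-T₀) T₀) (fun _ : ℝ => Real.exp (-(D₀ / 5)))) :=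
    (integrableOn_const (by simp : volume (Set.Icc (-T₀) T₀) ≠ ⊤)).integrable_indicator measurableSet_Icc
  have hRat : Integrable fun t : ℝ => (2 * Cl / T₀) / (T₀ ^ 2 + t ^ 2) := integrable_const_div_sq_add_sq hT₀ _
  have hMint : Integrable M := by
    simp only [hM]
    exact (hInd.add hRat).const_mul _
  have hMval : ∫ t, M t = X ^ σ * smoothZeta σ y * (2 * T₀ * Real.exp (-(D₀ / 5)) + 2 * π * Cl / T₀ ^ 2) := by
    simp only [hM]
    rw [integral_const_mul, integral_add hInd hRat, integral_indicator measurableSet_Icc,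
      setIntegral_const, integral_const_div_sq_add_sq hT₀]
    simp only [smul_eq_mul]
    rw [Real.volume_real_Icc_of_le (by linarith)]
    field_simp
    ring
  calc 1 / (2 * π) * ‖∫ t, F t‖ ≤ 1 / (2 * π) * ∫ t, M t := by
        apply mul_le_mul_of_nonneg_left _ (by positivity)
        exact norm_integral_le_of_norm_le hMint (Eventually.of_forall hpt)
    _ = _ := by rw [hMval]; ring

end TwistedWeight

end Literature.NumberTheory.Sieve

end
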